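import Mathlib.Algebra.FreeAbelianGroup.Finsupp
import Mathlib.GroupTheory.FreeGroup.NielsenSchreier
import Mathlib.GroupTheory.Schreier
import Mathlib.RingTheory.Finiteness.Cardinality
import Literature.IUT.HodgeTheaters.ProfiniteCompletionExtension
import Literature.IUT.HodgeTheaters.TemperedCoveringsProp24StrongTorsionFree
import HarnessLib

/-!
# [IUTchI] Prop. 2.4 (i), sub-node (L2a) at the MODEL: open subgroups of the profinite completion of a
# finitely generated free group have torsion-free abelianization ("[Config] Rmk 1.2.2")

Mochizuki, *Inter-universal Teichmüller theory I*, kurims manuscript (May 2020), §2, proof of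
Proposition 2.4 (i), p. 50 l. 27: "since [as is well-known — cf., e.g., [Config], Remark 1.2.2] `Δ̂_X` is
*strongly torsion-free*" [cite: Mochizuki2012, Prop 2.4(i) p.50] (D-0012 claim key; nothing of the series
is asserted here).  PROOF-ONLY file (seat abc-iut-w4-d055; sub-DAG plan/L5/SUBDAG-IUTchI-Prop24.md,
sub-row P24i.r4), continuing `TemperedCoveringsProp24StrongTorsionFree.lean`: there the typed `Σ`-form
`StableCurveTemperedData.StronglyTorsionFreeSigma` was derived from the PRINTED form "every open subgroup
of `Δ̂_X` has torsion-free abelianization" (character language, `SigmaCharDetects Set.univ`).  Here the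
printed form is PROVED for the group that `Δ̂_X` is in the IUT application — the profinite completion `Ĝ`
of a finitely generated FREE group `G` (the geometric fundamental group of an AFFINE hyperbolic curve,
e.g. a punctured elliptic curve, is free profinite; [EtTh] §1 "`Δ_X` is a profinite free group on 2
generators", the tree's `IsFreeProfiniteOn`):

* `ProfiniteCompletion.sigmaCharDetects_univ_pow_of_isFreeGroup` — for `U ⊆ Ĝ` open, `u ∈ U` and
  `n ≠ 0`: if some continuous character of `U` to a finite abelian group is nontrivial on `u`, then some
  such character is nontrivial on `u ^ n`.  Proof (abc-iut-L5-t17's extension lemma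
  `ProfiniteCompletion.exists_extension` + Nielsen–Schreier + Schreier's lemma): `H := η⁻¹(U)` is a
  finitely generated free group, so `H^ab ≅ ℤ^ι` with `ι` finite; the "coordinates mod `n·d`" character
  `H → (ℤ/nd)^ι`, `d := [G : N₂]` for a level `N₂` below the continuity levels of `U` and of the given
  character, extends to a continuous character `θ` of `U`; if `θ(u)^n = 1` then the abelianization class of
  an `N₂`-approximation `t ∈ H` of `u` lies in `d·H^ab ⊆ image(N₂)`, forcing the given character to
  vanish on `u`.
* `StableCurveTemperedData.stronglyTorsionFreeSigma_of_mulEquiv_profiniteCompletion` — hence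
  `StronglyTorsionFreeSigma D` for every datum whose `Δ̂_X` is identified, as a topological group, with
  such a `Ĝ` (the identification is the L3/L5 merge datum; nothing else is assumed).

No new definition, no new Literature fact; nothing here bears on [IUTchIII] Cor. 3.12.
-/

namespace Literature.IUT.HodgeTheaters

open CategoryTheory ProfiniteGrp ProfiniteGrp.ProfiniteCompletion Topology

universe u

/-! ### Two generalities -/

/-- A homomorphism with open kernel into a discrete group is continuous. [folklore] -/
private theorem SigmaCharDetects.continuous_of_isOpen_ker {P : Type*} [Group P] [TopologicalSpace P]
    [ContinuousMul P] {B : Type*} [Group B] [TopologicalSpace B] [DiscreteTopology B] (ψ : P →* B)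
    (h : IsOpen ((ψ.ker : Subgroup P) : Set P)) : Continuous ψ := by
  refine continuous_def.2 fun s _ => isOpen_iff_mem_nhds.2 fun x hx => ?_
  have ho : IsOpen ((fun y : P => x⁻¹ * y) ⁻¹' ((ψ.ker : Subgroup P) : Set P)) :=
    h.preimage (continuous_const.mul continuous_id)
  refine Filter.mem_of_superset (ho.mem_nhds (by simp)) fun y hy => ?_
  have hy' : ψ (x⁻¹ * y) = 1 := hy
  rw [map_mul, map_inv, inv_mul_eq_one] at hy'
  show ψ y ∈ s
  rw [← hy']
  exact hx

/-- A finitely generated free group has a FINITE free basis (its abelianization `≅ ℤ^{(ι)}` is a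
finitely generated `ℤ`-module). [folklore] -/
private theorem SigmaCharDetects.finite_generators_of_fg (H : Type u) [Group H] [IsFreeGroup H] [Group.FG H] :
    Finite (IsFreeGroup.Generators H) := by
  let b : FreeGroupBasis (IsFreeGroup.Generators H) H := IsFreeGroup.basis H
  let e₁ : Additive (Abelianization H) ≃+ FreeAbelianGroup (IsFreeGroup.Generators H) :=
    MulEquiv.toAdditive b.repr.abelianizationCongr
  let e₂ : FreeAbelianGroup (IsFreeGroup.Generators H) ≃+ (IsFreeGroup.Generators H →₀ ℤ) :=
    FreeAbelianGroup.equivFinsupp _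
  have hof : Function.Surjective (Abelianization.of : H →* Abelianization H) := QuotientGroup.mk_surjective
  haveI : Group.FG (Abelianization H) := Group.fg_of_surjective hof
  haveI : Module.Finite ℤ (Additive (Abelianization H)) := Module.Finite.iff_addGroup_fg.2 inferInstance
  haveI : Module.Finite ℤ (IsFreeGroup.Generators H →₀ ℤ) :=
    Module.Finite.equiv (e₁.trans e₂).toIntLinearEquiv
  exact Module.Finite.finite_basis (Finsupp.basisSingleOne (R := ℤ) (ι := IsFreeGroup.Generators H))

namespace ProfiniteCompletion

variable {G : Type u} [Group G]

/-- **Open subgroups of the profinite completion of a finitely generated free group have torsion-free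
abelianization** — in the character language of `SigmaCharDetects` (all finite abelian targets,
`Σ := Set.univ`): detection of `u ∈ U` by a continuous finite abelian character persists to `u ^ n`,
`n ≠ 0`.  This is "[Config] Rmk 1.2.2: `Δ̂_X` is strongly torsion-free" (p. 50 l. 27) for `Δ̂_X` free
profinite of finite rank. [cite: Mochizuki2012, Prop 2.4(i) p.50] -/
theorem sigmaCharDetects_univ_pow_of_isFreeGroup [IsFreeGroup G] [Group.FG G]
    (U : Subgroup (profiniteCompletion G)) (hU : IsOpen (U : Set (profiniteCompletion G)))
    (u : U) (n : ℕ) (hn : n ≠ 0) (hdet : SigmaCharDetects Set.univ U u) :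
    SigmaCharDetects Set.univ U (u ^ n) := by
  classical
  obtain ⟨A, _, _, χ, hχker, -, hχu⟩ := hdet
  -- continuity levels: `U ⊇ P_{N₀}`, `χ` kills `P_{N₁} ∩ U`
  obtain ⟨N₀, hN₀⟩ := exists_val_eq_one_mem_of_isOpen hU
  letI : TopologicalSpace A := ⊥
  haveI : DiscreteTopology A := ⟨rfl⟩
  obtain ⟨N₁, hN₁⟩ :=
    exists_val_eq_one_map_eq_one χ (SigmaCharDetects.continuous_of_isOpen_ker χ hχker)
  let N₂ : FiniteIndexNormalSubgroup G := N₀ ⊓ N₁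
  -- the discrete part `H = η⁻¹(U)`: finite index, finitely generated, free
  let H : Subgroup G := U.comap (toCompletion G)
  have hmemH : ∀ g : G, g ∈ H ↔ toCompletion G g ∈ U := fun g => Iff.rfl
  have hval_eta : ∀ (g : G) (N : FiniteIndexNormalSubgroup G),
      (toCompletion G g).val N = (QuotientGroup.mk g : G ⧸ N.toSubgroup) := fun g N => rfl
  have hN₂U : ∀ g : G, g ∈ N₂.toSubgroup → toCompletion G g ∈ U := by
    intro g hg
    apply hN₀
    change (QuotientGroup.mk g : G ⧸ N₀.toSubgroup) = 1
    rw [QuotientGroup.eq_one_iff]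
    exact (inf_le_left : N₂ ≤ N₀) hg
  have hN₂kill : ∀ g : G, g ∈ N₂.toSubgroup → ∀ hg : toCompletion G g ∈ U,
      χ ⟨toCompletion G g, hg⟩ = 1 := by
    intro g hg hgU
    apply hN₁
    change (QuotientGroup.mk g : G ⧸ N₁.toSubgroup) = 1
    rw [QuotientGroup.eq_one_iff]
    exact (inf_le_right : N₂ ≤ N₁) hg
  haveI hHfi : H.FiniteIndex :=
    Subgroup.finiteIndex_of_le (H := N₀.toSubgroup) fun g hg => by
      rw [hmemH]
      apply hN₀
      change (QuotientGroup.mk g : G ⧸ N₀.toSubgroup) = 1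
      rw [QuotientGroup.eq_one_iff]
      exact hg
  haveI : Group.FG H := Subgroup.fg_of_index_ne_zero H
  let ι := IsFreeGroup.Generators H
  let b : FreeGroupBasis ι H := IsFreeGroup.basis H
  haveI : Finite ι := SigmaCharDetects.finite_generators_of_fg H
  -- abelianization coordinates `c : H → ℤ^ι`
  let E : Additive (Abelianization H) ≃+ (ι →₀ ℤ) :=
    (MulEquiv.toAdditive b.repr.abelianizationCongr).trans (FreeAbelianGroup.equivFinsupp ι)
  let c : H → ι →₀ ℤ := fun h => E (Additive.ofMul (Abelianization.of h))
  have c_mul : ∀ h h' : H, c (h * h') = c h + c h' := by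
    intro h h'
    simp only [c, map_mul, ofMul_mul, map_add]
  have c_one : c 1 = 0 := by simp only [c, map_one, ofMul_one, map_zero]
  have c_pow : ∀ (h : H) (k : ℕ), c (h ^ k) = k • c h := by
    intro h k
    induction k with
    | zero => rw [pow_zero, c_one, zero_smul]
    | succ k ih => rw [pow_succ, c_mul, ih, succ_nsmul]
  have c_inv : ∀ h : H, c h⁻¹ = - c h := by
    intro h
    rw [eq_neg_iff_add_eq_zero, ← c_mul, inv_mul_cancel, c_one]
  have c_surj : Function.Surjective c := by
    intro f
    obtain ⟨a, ha⟩ := E.surjective f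
    obtain ⟨h, hh⟩ := QuotientGroup.mk_surjective (Additive.toMul a)
    refine ⟨h, ?_⟩
    change E (Additive.ofMul (Abelianization.of h)) = f
    have : Abelianization.of h = Additive.toMul a := hh
    rw [this, ofMul_toMul, ha]
  have c_ker : ∀ h : H, c h = 0 → ∀ f : H →* A, f h = 1 := by
    intro h hc f
    have h1 : Abelianization.of h = 1 := by
      have : Additive.ofMul (Abelianization.of h) = 0 := E.injective (by rw [map_zero]; exact hc)
      exact ofMul_eq_zero.mp this
    rw [← Abelianization.lift_apply_of f h, h1, map_one]
  -- the index `d := [G : N₂]` and the modulus `M := n·d`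
  let d : ℕ := N₂.toSubgroup.index
  have hd : d ≠ 0 := Subgroup.FiniteIndex.index_ne_zero
  let M : ℕ := n * d
  haveI : NeZero M := ⟨mul_ne_zero hn hd⟩
  -- the character "coordinates mod M" of `H`
  let θ₀ : H →* Multiplicative (ι → ZMod M) :=
    MonoidHom.mk' (fun h => Multiplicative.ofAdd fun i => ((c h i : ℤ) : ZMod M)) (by
      intro h h'
      rw [← ofAdd_add]
      congr 1
      funext i
      rw [c_mul, Finsupp.add_apply, Int.cast_add, Pi.add_apply])
  have hθ₀ : ∀ (h : H) (i : ι), Multiplicative.toAdd (θ₀ h) i = ((c h i : ℤ) : ZMod M) := fun h i => rfl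
  -- extend it to a continuous character `θ` of `U`
  obtain ⟨θ, N, hNle, hθ⟩ := exists_extension N₀ hN₀ θ₀
  have hθker : IsOpen ((θ.ker : Subgroup U) : Set U) := by
    apply Subgroup.isOpen_of_mem_nhds (g := 1)
    haveI : DiscreteTopology ((diagram (GrpCat.of G)).obj N) := ⟨rfl⟩
    have ho : IsOpen ((fun x : U => (x : profiniteCompletion G).val N) ⁻¹' {1}) :=
      (isOpen_discrete _).preimage ((continuous_val N).comp continuous_subtype_val)
    have h1 : (1 : U) ∈ (fun x : U => (x : profiniteCompletion G).val N) ⁻¹' {1} := by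
      rw [Set.mem_preimage, Set.mem_singleton_iff]; rfl
    refine Filter.mem_of_superset (ho.mem_nhds h1) fun x hx => ?_
    rw [Set.mem_preimage, Set.mem_singleton_iff] at hx
    have hx' : (x : profiniteCompletion G).val N = (QuotientGroup.mk (1 : G) : G ⧸ N.toSubgroup) := by
      rw [QuotientGroup.mk_one]; exact hx
    have := hθ x x.2 1 H.one_mem hx'
    rw [SetLike.mem_coe, MonoidHom.mem_ker]
    rw [show θ x = θ ⟨x, x.2⟩ from rfl, this]
    exact map_one θ₀
  -- an approximation `t ∈ H` of `u` at the level `N ⊓ N₂`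
  let Ns : FiniteIndexNormalSubgroup G := N ⊓ N₂
  obtain ⟨t, ht⟩ : ∃ t : G, (u : profiniteCompletion G).val Ns = (QuotientGroup.mk t : G ⧸ Ns.toSubgroup) := by
    obtain ⟨t, ht⟩ := QuotientGroup.mk_surjective ((u : profiniteCompletion G).val Ns)
    exact ⟨t, ht.symm⟩
  have htH : t ∈ H :=
    mem_comap_of_val_eq hN₀ (le_trans inf_le_right inf_le_left : Ns ≤ N₀) u.2 ht
  have htU : toCompletion G t ∈ U := htH
  have hθu : θ u = θ₀ ⟨t, htH⟩ := by
    have := hθ u u.2 t htH (val_mk_eq_of_le _ (inf_le_left : Ns ≤ N) t ht)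
    exact this
  have hχt : χ u = χ ⟨toCompletion G t, htU⟩ := by
    have h1 : ((u : profiniteCompletion G)⁻¹ * toCompletion G t).val N₁ = 1 := by
      apply val_eq_one_of_le _ (le_trans inf_le_right inf_le_right : Ns ≤ N₁)
      change ((u : profiniteCompletion G).val Ns)⁻¹ * (toCompletion G t).val Ns = 1
      rw [ht]
      exact inv_mul_cancel _
    have h2 := hN₁ _ (U.mul_mem (U.inv_mem u.2) htU) h1
    have h3 : χ (u⁻¹ * ⟨toCompletion G t, htU⟩) = 1 := h2
    rwa [map_mul, map_inv, inv_mul_eq_one] at h3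
  -- the restriction of `χ` to `H` along `η`
  let ηH : H →* U := MonoidHom.mk' (fun h => ⟨toCompletion G h, h.2⟩) (fun h h' => Subtype.ext (by
    simp only [Subgroup.coe_mul, map_mul]))
  let χH : H →* A := χ.comp ηH
  have hχHt : χH ⟨t, htH⟩ = χ u := by rw [hχt]; rfl
  -- `θ` detects `u ^ n`
  refine ⟨Multiplicative (ι → ZMod M), inferInstance, inferInstance, θ, hθker,
    fun p _ _ => Set.mem_univ p, fun hcontra => hχu ?_⟩
  rw [map_pow, hθu] at hcontra
  -- all coordinates of `t` are divisible by `d`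
  have hdiv : ∀ i : ι, (d : ℤ) ∣ c ⟨t, htH⟩ i := by
    intro i
    have h1 : Multiplicative.toAdd (θ₀ ⟨t, htH⟩ ^ n) i = 0 := by rw [hcontra]; rfl
    rw [toAdd_pow, Pi.smul_apply, hθ₀, nsmul_eq_mul, ← Int.cast_natCast, ← Int.cast_mul,
      ZMod.intCast_zmod_eq_zero_iff_dvd] at h1
    have h2 : ((n : ℤ) * d) ∣ (n : ℤ) * c ⟨t, htH⟩ i := by exact_mod_cast h1
    exact Int.dvd_of_mul_dvd_mul_left (by exact_mod_cast hn) h2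
  -- hence `c t = d • f = c (h_f ^ d)` with `h_f ^ d ∈ N₂`
  let f : ι →₀ ℤ := Finsupp.mapRange (fun z : ℤ => z / d) (by simp) (c ⟨t, htH⟩)
  have hf : c ⟨t, htH⟩ = d • f := by
    ext i
    simp only [f, Finsupp.smul_apply, Finsupp.mapRange_apply, nsmul_eq_mul]
    exact (Int.mul_ediv_cancel' (hdiv i)).symm
  obtain ⟨hf₀, hhf₀⟩ := c_surj f
  have hmem : ((hf₀ : H) : G) ^ d ∈ N₂.toSubgroup := Subgroup.pow_index_mem N₂.toSubgroup _
  have hcz : c (⟨t, htH⟩ * (hf₀ ^ d)⁻¹) = 0 := by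
    rw [c_mul, c_inv, c_pow, hhf₀, ← hf, add_neg_cancel]
  have hkill : χH (hf₀ ^ d) = 1 := by
    change χ ⟨toCompletion G ((hf₀ ^ d : H) : G), _⟩ = 1
    exact hN₂kill _ (by rw [Subgroup.coe_pow]; exact hmem) _
  have := c_ker _ hcz χH
  rw [map_mul, map_inv, hkill, inv_one, mul_one, hχHt] at this
  exact this

end ProfiniteCompletion

/-! ### The L5 corollary at the model -/

namespace StableCurveTemperedData

variable {D : StableCurveTemperedData.{u}}

/-- **[IUTchI] Prop. 2.4 (i), input "`Δ̂_X` is strongly torsion-free" DISCHARGED AT THE MODEL**: if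
`Δ̂_X` is identified, as a topological group, with the profinite completion of a finitely generated free
group (the affine hyperbolic case of the IUT application), then abc-iut-w5-d119's typed sub-node
`StronglyTorsionFreeSigma D` HOLDS (for `Π̂_X` totally disconnected and `Δ̂_X` closed).  Composition of
`ProfiniteCompletion.sigmaCharDetects_univ_pow_of_isFreeGroup` (printed form at the model) with
`stronglyTorsionFreeSigma_of_torsionFreeAb` (printed form ⇒ typed `Σ`-form), transporting characters along
the identification. [cite: Mochizuki2012, Prop 2.4(i) p.50] -/
theorem stronglyTorsionFreeSigma_of_mulEquiv_profiniteCompletion [TotallyDisconnectedSpace D.PiHat]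
    (hΔc : D.DeltaHatClosed) {G : Type u} [Group G] [IsFreeGroup G] [Group.FG G]
    (e : D.DeltaHat ≃ₜ* profiniteCompletion G) : D.StronglyTorsionFreeSigma := by
  classical
  refine stronglyTorsionFreeSigma_of_torsionFreeAb hΔc fun H hH h n hn hdet => ?_
  -- transport `H`, `h` and the character along `e`
  let H' : Subgroup (profiniteCompletion G) :=
    H.comap (e.symm : profiniteCompletion G ≃* D.DeltaHat).toMonoidHom
  have hmemH' : ∀ y, y ∈ H' ↔ e.symm y ∈ H := fun y => Iff.rfl
  have hH' : IsOpen (H' : Set (profiniteCompletion G)) := by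
    have : (H' : Set (profiniteCompletion G)) = e.symm ⁻¹' (H : Set D.DeltaHat) := rfl
    rw [this]
    exact hH.preimage e.symm.continuous
  -- the isomorphism `H ≃* H'` induced by `e`, continuous both ways
  let eH : H ≃* H' :=
    { toFun := fun x => ⟨e x.1, by rw [hmemH', ContinuousMulEquiv.symm_apply_apply]; exact x.2⟩
      invFun := fun y => ⟨e.symm y.1, y.2⟩
      left_inv := fun x => Subtype.ext (e.symm_apply_apply x.1)
      right_inv := fun y => Subtype.ext (e.apply_symm_apply y.1)
      map_mul' := fun x y => Subtype.ext (map_mul e x.1 y.1) }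
  have eH_cont : Continuous eH :=
    Continuous.subtype_mk (e.continuous.comp continuous_subtype_val) _
  have eH_symm_cont : Continuous eH.symm :=
    Continuous.subtype_mk (e.symm.continuous.comp continuous_subtype_val) _
  -- characters move back and forth
  have fwd : ∀ (x : H), SigmaCharDetects Set.univ H x → SigmaCharDetects Set.univ H' (eH x) := by
    rintro x ⟨A, iA, iF, χ, hχker, hS, hχx⟩
    refine ⟨A, iA, iF, χ.comp eH.symm.toMonoidHom, ?_, hS, ?_⟩
    · have : (((χ.comp eH.symm.toMonoidHom).ker : Subgroup H') : Set H') =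
          eH.symm ⁻¹' ((χ.ker : Subgroup H) : Set H) := by
        ext y; simp only [SetLike.mem_coe, MonoidHom.mem_ker, MonoidHom.comp_apply, Set.mem_preimage]; rfl
      rw [this]
      exact hχker.preimage eH_symm_cont
    · rw [MonoidHom.comp_apply, MulEquiv.coe_toMonoidHom, MulEquiv.symm_apply_apply]
      exact hχx
  have bwd : ∀ (x : H), SigmaCharDetects Set.univ H' (eH x) → SigmaCharDetects Set.univ H x := by
    rintro x ⟨A, iA, iF, χ, hχker, hS, hχx⟩
    refine ⟨A, iA, iF, χ.comp eH.toMonoidHom, ?_, hS, ?_⟩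
    · have : (((χ.comp eH.toMonoidHom).ker : Subgroup H) : Set H) =
          eH ⁻¹' ((χ.ker : Subgroup H') : Set H') := by
        ext y; simp only [SetLike.mem_coe, MonoidHom.mem_ker, MonoidHom.comp_apply, Set.mem_preimage]; rfl
      rw [this]
      exact hχker.preimage eH_cont
    · rw [MonoidHom.comp_apply, MulEquiv.coe_toMonoidHom]
      exact hχx
  have := ProfiniteCompletion.sigmaCharDetects_univ_pow_of_isFreeGroup H' hH' (eH h) n hn (fwd h hdet)
  rw [← map_pow] at this
  exact bwd (h ^ n) this

end StableCurveTemperedData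

end Literature.IUT.HodgeTheaters
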